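import Mathlib.LinearAlgebra.Matrix.SpecialLinearGroup
import Mathlib.LinearAlgebra.Matrix.Notation
import Mathlib.Algebra.Star.Basic
import Literature.Computability.AlgebraicComplexity.CohnUmansSL2TPP
import HarnessLib

/-!
# Cohn–Umans 2003, Prop. 5.2 (arXiv Prop. 11): `SL₂(𝔽_{q²})` realizes `⟨q², q², |SU₂(𝔽_q)|⟩` — the TPP of
# `U`, `L` and `SU₂`

Topic `Literature/Computability/AlgebraicComplexity` (group-theoretic matrix multiplication), namespace
`Literature.Computability.AlgebraicComplexity`; sequel to `CohnUmansSL2TPP.lean` (Prop. 5.1, `upperHom`, `lowerHom`).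

H. Cohn, C. Umans, *A group-theoretic approach to fast matrix multiplication*, FOCS 2003 = arXiv:math/0307321, §5
"Linear groups" (Proposition 11 of the arXiv text, pp. 7–8), verbatim:

> "**Proposition 11.** The group `SL₂(𝔽_{q²})` of order `q⁶ − q²` realizes `⟨q², q², q³ − q⟩`.
> *Proof.* Let `x ↦ x̄` denote the Frobenius automorphism of `𝔽_{q²}` over `𝔽_q`. The three subgroups we will use
> are `H₁ = {(1 x; 0 1) : x ∈ 𝔽_{q²}}`, `H₂ = {(1 0; y 1) : y ∈ 𝔽_{q²}}`, and
> `H₃ = SU₂(𝔽_q) = {(a b; −b̄ ā) : a, b ∈ 𝔽_{q²}, a ā + b b̄ = 1}`. Note that to check that `|H₃| = q³ − q`, one just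
> needs to count solutions to `a ā + b b̄ = 1`. […] As in the previous proof, checking the triple product property
> amounts to checking that `(1+xy x; y 1) = (a b; −b̄ ā)` implies `x = y = b = 0` and `a = 1`, which is a trivial
> calculation."

("Proposition 11 proves that `lim inf_{q→∞} α(SL₂(𝔽_q)) ≤ 18/7`.")

## Lean rendering

Over any commutative ring `R` with a star (= an involutive ring automorphism `x ↦ x̄`; for `R = 𝔽_{q²}` the
Frobenius over `𝔽_q`): `su2 R ≤ SL(2, R)` is the subgroup of matrices `(a b; −b̄ ā)` (`su2`, closed under products
and inverses by the computation in `mul_mem'`/`inv_mem'`); the printed "trivial calculation" is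
`CohnUmans2003_prop11_eq` (it needs `x x̄ = 0 ⇒ x = 0`, i.e. no zero divisors); and for a finite such `R`
(`|R| = q²` in the paper) **`CohnUmans2003_prop11 : RealizesTPP (SL(2, R)) |R| |R| |su2 R|`** in the tree's sense.

Here the third size is stated as `Nat.card (su2 R)`; the printed count `|SU₂(𝔽_q)| = q³ − q` (fibres of the norm
`a ↦ a ā` of size `q + 1`) and the literal form `RealizesTPP (SL(2, 𝔽_{q²})) (q²) (q²) (q³ − q)` are proved in the
sequel `CohnUmansSU2Card.lean` (`CohnUmans2003_prop11_natCard_su2`, `CohnUmans2003_prop11_literal`).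

## References
* H. Cohn, C. Umans, FOCS 2003, 438–449; arXiv:math/0307321, §5, Prop. 11 of the arXiv text (pp. 7–8)
  (= Prop. 5.2 of the FOCS version, the second proposition of §5). [CohnUmans2003]
-/

namespace Literature.Computability.AlgebraicComplexity

open Finset Matrix Literature.Combinatorics.Additive

section Ring

variable (R : Type*) [CommRing R] [StarRing R]

/-- **`SU₂` over `(R, ¯)`**: the matrices `(a b; −b̄ ā)` of determinant `1` ("`H₃ = SU₂(𝔽_q) = {(a b; −b̄ ā) :
a ā + b b̄ = 1}`"), as a subgroup of `SL(2, R)`. [cite: CohnUmans2003, Prop. 11 (arXiv; proof)] -/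
def su2 : Subgroup (SpecialLinearGroup (Fin 2) R) where
  carrier := {M | (M : Matrix (Fin 2) (Fin 2) R) 1 0 = -star ((M : Matrix (Fin 2) (Fin 2) R) 0 1) ∧
    (M : Matrix (Fin 2) (Fin 2) R) 1 1 = star ((M : Matrix (Fin 2) (Fin 2) R) 0 0)}
  mul_mem' {A B} hA hB := by
    obtain ⟨hA1, hA2⟩ := hA
    obtain ⟨hB1, hB2⟩ := hB
    simp only [Set.mem_setOf_eq, SpecialLinearGroup.coe_mul, Matrix.mul_apply, Fin.sum_univ_two] at *
    rw [hA1, hA2, hB1, hB2]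
    constructor
    · simp only [star_add, star_mul', star_star]; ring
    · simp only [star_add, star_mul', star_star, star_neg]; ring
  one_mem' := by simp
  inv_mem' {A} hA := by
    obtain ⟨hA1, hA2⟩ := hA
    simp only [Set.mem_setOf_eq, SpecialLinearGroup.coe_inv, Matrix.adjugate_fin_two, Matrix.of_apply,
      Matrix.cons_val', Matrix.cons_val_zero, Matrix.cons_val_one, Matrix.empty_val', Matrix.cons_val_fin_one]
    constructor
    · rw [hA1, star_neg]
    · rw [hA2, star_star]

variable {R}

/-- Membership in `su2`. [cite: CohnUmans2003, Prop. 11 (arXiv; proof)] -/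
theorem mem_su2 {M : SpecialLinearGroup (Fin 2) R} :
    M ∈ su2 R ↔ (M : Matrix (Fin 2) (Fin 2) R) 1 0 = -star ((M : Matrix (Fin 2) (Fin 2) R) 0 1) ∧
      (M : Matrix (Fin 2) (Fin 2) R) 1 1 = star ((M : Matrix (Fin 2) (Fin 2) R) 0 0) := Iff.rfl

/-- Membership in `su2` is decidable when equality in `R` is. [folklore] -/
instance [DecidableEq R] : DecidablePred (· ∈ su2 R) := fun _ => decidable_of_iff _ mem_su2.symm

/-- **The printed "trivial calculation"**: `(1 x; 0 1)(1 0; y 1) = (1+xy x; y 1) = (a b; −b̄ ā)` forces `x = y = 0`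
(so `b = 0`, `a = 1`): from `ā = 1` and `y = −x̄` one gets `1 + x y = a = 1`, `x x̄ = 0`, hence `x = 0` (no zero
divisors). [cite: CohnUmans2003, Prop. 11 (arXiv, pp. 7–8; proof)] -/
theorem CohnUmans2003_prop11_eq [NoZeroDivisors R] (x y : Multiplicative R) (M : su2 R)
    (h : upperHom x * lowerHom y = (M : SpecialLinearGroup (Fin 2) R)) : x = 1 ∧ y = 1 ∧ M = 1 := by
  obtain ⟨M, hM1, hM2⟩ := M
  have h' := congrArg (fun g : SpecialLinearGroup (Fin 2) R => (g : Matrix (Fin 2) (Fin 2) R)) h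
  simp only [upperHom, lowerHom, MonoidHom.coe_mk, OneHom.coe_mk, SpecialLinearGroup.coe_mul] at h'
  have h00 := congrFun (congrFun h' 0) 0
  have h11 := congrFun (congrFun h' 1) 1
  have h01 := congrFun (congrFun h' 0) 1
  have h10 := congrFun (congrFun h' 1) 0
  simp [Matrix.mul_apply, Fin.sum_univ_two] at h00 h11 h01 h10
  -- `h00 : 1 + x y = M 0 0`, `h11 : 1 = M 1 1`, `h01 : x = M 0 1`, `h10 : y = M 1 0`
  have ha : (M : Matrix (Fin 2) (Fin 2) R) 0 0 = 1 := by
    have := congrArg star hM2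
    rw [star_star, ← h11, star_one] at this
    exact this.symm
  have hxy : Multiplicative.toAdd x * Multiplicative.toAdd y = 0 := by
    have := h00; rw [ha] at this; linear_combination this
  have hy : Multiplicative.toAdd y = -star (Multiplicative.toAdd x) := by rw [h10, hM1, ← h01]
  have hx : Multiplicative.toAdd x = 0 := by
    rw [hy, mul_neg, neg_eq_zero] at hxy
    rcases mul_eq_zero.mp hxy with h0 | h0
    · exact h0
    · simpa using congrArg star h0
  have hy0 : Multiplicative.toAdd y = 0 := by rw [hy, hx, star_zero, neg_zero]
  refine ⟨toAdd_eq_zero.1 hx, toAdd_eq_zero.1 hy0, Subtype.ext ?_⟩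
  -- `M = 1`
  rw [show (x : Multiplicative R) = 1 from toAdd_eq_zero.1 hx, show y = 1 from toAdd_eq_zero.1 hy0, map_one,
    map_one, mul_one] at h
  exact h.symm

end Ring

/-- For subgroups (`Q(Hᵢ) = Hᵢ`) the tree's right-quotient TPP follows from "`h₁h₂ = h₃` forces `hᵢ = 1`"
(CU03, remark after Def. 2.1). [folklore] -/
private theorem tpp_image_of_homs₃ {K₁ K₃ G : Type*} [Group K₁] [Group K₃] [Group G] [Fintype K₁] [Fintype K₃]
    [DecidableEq G] (φ₁ φ₂ : K₁ →* G) (φ₃ : K₃ →* G)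
    (h : ∀ a b c, φ₁ a * φ₂ b = φ₃ c → a = 1 ∧ b = 1 ∧ c = 1) :
    TripleProductProperty (univ.image φ₁) (univ.image φ₂) (univ.image φ₃) := by
  intro s hs s' hs' t ht t' ht' u hu u' hu' heq
  obtain ⟨a, -, rfl⟩ := mem_image.1 hs
  obtain ⟨a', -, rfl⟩ := mem_image.1 hs'
  obtain ⟨b, -, rfl⟩ := mem_image.1 ht
  obtain ⟨b', -, rfl⟩ := mem_image.1 ht'
  obtain ⟨c, -, rfl⟩ := mem_image.1 hu
  obtain ⟨c', -, rfl⟩ := mem_image.1 hu'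
  have key : φ₁ (a * a'⁻¹) * φ₂ (b * b'⁻¹) = φ₃ (c' * c⁻¹) := by
    rw [map_mul, map_inv, map_mul, map_inv, map_mul, map_inv]
    calc φ₁ a * (φ₁ a')⁻¹ * (φ₂ b * (φ₂ b')⁻¹)
        = φ₁ a * (φ₁ a')⁻¹ * (φ₂ b * (φ₂ b')⁻¹) * (φ₃ c * (φ₃ c')⁻¹) * (φ₃ c * (φ₃ c')⁻¹)⁻¹ := by group
      _ = φ₃ c' * (φ₃ c)⁻¹ := by rw [heq]; group
  obtain ⟨h1, h2, h3⟩ := h _ _ _ key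
  exact ⟨by rw [mul_inv_eq_one.1 h1], by rw [mul_inv_eq_one.1 h2], by rw [mul_inv_eq_one.1 h3]⟩

/-- **Cohn–Umans 2003, Prop. 11 (arXiv) / Prop. 5.2 (FOCS), realization form**: for a finite commutative ring `R`
with a star and no zero divisors (the paper: `R = 𝔽_{q²}`, `¯` = Frobenius over `𝔽_q`), `SL₂(R)` realizes
`⟨|R|, |R|, |SU₂|⟩` through `H₁ = U`, `H₂ = L`, `H₃ = su2 R` (the printed sizes: `q², q², q³ − q`; the count
`|SU₂(𝔽_q)| = q³ − q` is `CohnUmans2003_prop11_natCard_su2` in `CohnUmansSU2Card.lean`).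
[cite: CohnUmans2003, Prop. 11 (arXiv, pp. 7–8)] -/
theorem CohnUmans2003_prop11 (R : Type*) [CommRing R] [StarRing R] [NoZeroDivisors R] [Fintype R]
    [DecidableEq R] :
    RealizesTPP (SpecialLinearGroup (Fin 2) R) (Fintype.card R) (Fintype.card R) (Nat.card (su2 R)) := by
  classical
  have h1 : Function.Injective (upperHom (R := R)) := fun x y h => by
    have := congrArg (fun g : SpecialLinearGroup (Fin 2) R => (g : Matrix (Fin 2) (Fin 2) R) 0 1) h
    simpa [upperHom] using this
  have h2 : Function.Injective (lowerHom (R := R)) := fun x y h => by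
    have := congrArg (fun g : SpecialLinearGroup (Fin 2) R => (g : Matrix (Fin 2) (Fin 2) R) 1 0) h
    simpa [lowerHom] using this
  have h3 : Function.Injective (su2 R).subtype := (su2 R).subtype_injective
  refine ⟨univ.image upperHom, univ.image lowerHom, univ.image (su2 R).subtype, ?_, ?_, ?_,
    tpp_image_of_homs₃ _ _ _ fun a b c h => CohnUmans2003_prop11_eq a b c h⟩
  · rw [card_image_of_injective _ h1, card_univ, Fintype.card_multiplicative]
  · rw [card_image_of_injective _ h2, card_univ, Fintype.card_multiplicative]
  · rw [card_image_of_injective _ h3, card_univ, Nat.card_eq_fintype_card]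

end Literature.Computability.AlgebraicComplexity
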